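import Literature.Computability.Cryptography.RegevReductionCVPLiftPre
import HarnessLib

/-!
# Regev 2009, Lemma 3.5 — the digit step of the post-processing program, on codes

Literature first-formalisation unit `b2b-lwe-3` (generation 6, sixth module), bundle
`papers/QuantumAdvantage/lwe-quantum-autopsy/`.  THE VALUE of this file is a set of THEOREMS about a
KNOWN reduction (O. Regev, *On lattices, learning with errors, random linear codes, and cryptography*,
J. ACM 56 (2009), Lemma 3.5) — NOT summit progress: nothing here bears on `BQP ≠ BPP`, on the hardness
of `LWE`, or on any open problem.

## What is proved

After `RegevReductionCVPLiftPre.lean` the named fact `A_lift` (`regev2009_lemma_3_5_liftFamily q`)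
hinges on ONE classical polynomial-time program, the post-processing `g` of the stages
(`regev2009_lemma_3_5_liftFamily_of_postFn`).  Its working stages do Regev's digit step — read the
`CVP^{(q)}` answer (the digits `a(x̃ᵢ) mod q`), subtract, divide by `q`, carry the partial sums
`Σ_{l<i} q^l rₗ`, write the next window.  This file builds those pieces as TOTAL typed functions with
their `CodeFP` certificates and their meaning on the true digit path (grouping namespace
`Regev2009.LiftPost`):

* reading — `readN_append_of_length` (reading `n` blocks ignores what follows them),
  **`readN_of_table_prefix`**, **`readN_answerTable`** (the first `n·size q` bits of ANY answer extending
  the true table `DigitOracle.answerTable q I t` read back to `List.ofFn (DigitOracle.digits q I t)` —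
  referee note N-14.1: off the true path the naturals read are arbitrary and nothing is checked),
  — the block width `Nat.size q` in unary and the modulus `q n` from `1ⁿ` are the tree's
  `QuantumComplexity.natSizeU_codeFP` and `CodeFP.codeFP_natParam` (from the `PolyTimeComputable`
  hypothesis of `A_lift`), not restated here;
* the step — **`stepL`** (`(x, r) ↦ ((xⱼ − rⱼ)/q)ⱼ` on lists) with **`stepL_ofFn`**
  (`= List.ofFn (DigitOracle.next q I t)` on the true iterate and digits) and **`codeFP_stepL`**;
  **`sumsL`** (`(S, r) ↦ (Sⱼ + qⁱ rⱼ)ⱼ`) with `sumsL_ofFn` and **`codeFP_sumsL`**;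
* the window — **`mkWindow m L S`** (`⟨listE encodeRat L, ⟨rawE intE S, []⟩⟩` cut/padded to width `m`
  by `takeD`) with `length_mkWindow`, **`mkWindow_eq_pairE`** (when the content fits, the window IS the
  code of the typed triple `(L, S, padding)` under `wE` — so the next stage parses it, and its first
  field is `listE encodeRat L` as `LiftPre.exists_liftPre` requires, `fstF_mkWindow`) and
  **`codeFP_mkWindow`**; `takeD_of_length_le` (the tree's `boolPair_append` of `ShorProofs.lean` is
  re-proved inline, not restated).

Everything is proved; definitions have bodies; no named fact is introduced; `A_lift` is NOT proved here
(what remains: the dispatch over stages, the finish at round `2n−1` — LLL, nearest plane on the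
reversed dual basis, `DigitOracle.coords_eq_of_isLLLReduced`, the offset-binary table — and the window
width polynomial, referee notes N-14.4/N-14.5/N-15.1–N-15.3 of the bundle).

## References

* O. Regev, *On lattices, learning with errors, random linear codes, and cryptography*, J. ACM 56 (2009),
  art. 34; author's version arXiv:2401.03703: Lemma 3.5 (proof, p. 19) [Regev2009].
* S. Arora, B. Barak, *Computational Complexity: A Modern Approach*, CUP 2009, §1.2–1.3 [AroraBarak2009].
-/

namespace Literature.Computability.Cryptography

open Filter _root_.Computability Literature.Computability.Complexity Literature.Computability.Complexity.CodeFP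
open Literature.Computability.QuantumComplexity Literature.Algebra.EuclideanLattices
open Regev2009 Regev2009.DigitOracle Regev2009.SamplerFormats Brick

namespace Regev2009

namespace LiftPost

/-! ### Reading the digits off an answer -/

/-- Reading `n` blocks of width `w` off a word of exactly `n·w` bits ignores anything appended.
[cite: AroraBarak2009, §1.3] -/
theorem readN_append_of_length {w n : ℕ} {T : List Bool} (hT : T.length = n * w) (rest : List Bool) :
    readN w n (T ++ rest) = readN w n T := by
  unfold readN
  refine List.map_congr_left fun i hi => ?_
  rw [List.mem_range] at hi
  have h1 : i * w + w ≤ T.length := by rw [hT, ← Nat.succ_mul]; exact Nat.mul_le_mul_right _ hi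
  rw [List.drop_append_of_le_length (by omega), List.take_append_of_le_length (by simp; omega)]

/-- **Any word extending the table of an in-range vector reads back to the vector.**
[cite: Regev2009, Lemma 3.5 (proof: "the CVP^{(q)} oracle … outputs L*/qL*")] -/
theorem readN_of_table_prefix {w n : ℕ} {s : Fin n → ℕ} (hs : ∀ j, s j < 2 ^ w) {yy : List Bool}
    (h : CVPOracle.table w s <+: yy) : readN w n yy = List.ofFn s := by
  obtain ⟨rest, rfl⟩ := h
  have hlen : (CVPOracle.table w s).length = n * w := by
    rw [← tableL_ofFn, length_tableL, List.length_ofFn]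
  rw [readN_append_of_length hlen, ← tableL_ofFn]
  have hs' : ∀ v ∈ List.ofFn s, v < 2 ^ w := fun v hv => by
    obtain ⟨j, rfl⟩ := (List.mem_ofFn' _ _).1 hv
    exact hs j
  have hr := readN_tableL hs'
  rwa [List.length_ofFn] at hr

/-- **The digits read off a correct `CVP^{(q)}` answer**: the first `n · size q` bits of any answer
extending `answerTable q I t` read back to `(digits q I t)ⱼ` (off the true path the naturals read are
arbitrary — nothing is checked; referee note N-14.1). [cite: Regev2009, Lemma 3.5 (proof)] -/
theorem readN_answerTable {q : ℕ} [NeZero q] (I : LatticeInstance) (t : Fin I.n → ℚ) {yy : List Bool}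
    (h : answerTable q I t <+: yy) : readN (Nat.size q) I.n yy = List.ofFn (digits q I t) :=
  readN_of_table_prefix (fun j => (digits_lt q I t j).trans (Nat.lt_size_self q)) h

/-! ### The digit step on lists -/

/-- **The digit step** `(x̃, r̃) ↦ ((x̃ⱼ − r̃ⱼ)/q)ⱼ` on lists (junk-tolerant: any naturals `r̃`, division
by `q = 0` is `0` in `ℚ`). [cite: Regev2009, Lemma 3.5 (proof: "x_{i+1} = (x_i − (a_i mod p))/p")] -/
def stepL (cq : ℕ) (L : List ℚ) (r : List ℕ) : List ℚ :=
  List.zipWith (fun (x : ℚ) (m : ℕ) => (x - m) / cq) L r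

/-- **The partial sums** `(S, r̃) ↦ (Sⱼ + qⁱ r̃ⱼ)ⱼ` (the back-substitution data `Σ_{l≤i} q^l r_l`).
[cite: Regev2009, Lemma 3.5 (proof: "a = Σ p^{i-1} (a_i mod p)")] -/
def sumsL (cq i : ℕ) (S : List ℤ) (r : List ℕ) : List ℤ :=
  List.zipWith (fun (s : ℤ) (m : ℕ) => s + (cq : ℤ) ^ i * m) S r

/-- **On the true iterate and its digits the step is Regev's `next`.** [cite: Regev2009, Lemma 3.5 (proof)] -/
theorem stepL_ofFn (q : ℕ) [NeZero q] (I : LatticeInstance) (t : Fin I.n → ℚ) :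
    stepL q (List.ofFn t) (List.ofFn (digits q I t)) = List.ofFn (next q I t) :=
  List.ext_getElem (by simp [stepL]) fun i h1 h2 => by simp [stepL, next]

/-- The partial sums on `ofFn` data. [folklore] -/
theorem sumsL_ofFn {n : ℕ} (cq i : ℕ) (S : Fin n → ℤ) (r : Fin n → ℕ) :
    sumsL cq i (List.ofFn S) (List.ofFn r) = List.ofFn fun j => S j + (cq : ℤ) ^ i * r j :=
  List.ext_getElem (by simp [sumsL]) fun i h1 h2 => by simp [sumsL]

/-- Code of the step's arguments: `(q, (x̃ as raw rationals, r̃))`. [cite: AroraBarak2009, §1.2] -/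
abbrev stepE : ℕ × List ℚ × List ℕ → List Bool := pairE natE (pairE (rawE encodeRat) (rawE natE))

/-- **The digit step is computed in polynomial time.** [cite: AroraBarak2009, §1.3] -/
theorem codeFP_stepL : CodeFP stepE (rawE encodeRat) (fun p => stepL p.1 p.2.1 p.2.2) := by
  -- the element map `(q, x, m) ↦ (x − m)/q`, assembled without cast-laden target ascriptions
  have hq : CodeFP (pairE natE (pairE encodeRat natE)) (pairE intE natE) (fun t => ((t.1 : ℤ), 1)) :=
    (intOfNat.comp (fst _ _)).pair (const _ 1)
  have hm : CodeFP (pairE natE (pairE encodeRat natE)) (pairE intE natE) (fun t => (-(t.2.2 : ℤ), 1)) :=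
    (intNeg.comp (intOfNat.comp (snd _ _).snd')).pair (const _ 1)
  have hx : CodeFP (pairE natE (pairE encodeRat natE)) encodeRat (fun t => t.2.1) := (snd _ _).fst'
  have hel := ratDiv.comp ((ratAdd.comp (hx.pair (ratOfIntNat.comp hm))).pair (ratOfIntNat.comp hq))
  have hel' : CodeFP (pairE natE (pairE encodeRat natE)) encodeRat
      (fun t => (t.2.1 - (t.2.2 : ℚ)) / (t.1 : ℚ)) :=
    hel.congr fun t => by push_cast; ring
  exact (zipWith hel').congr fun p => rfl

/-- Code of the partial sums' arguments: `((q, 1ⁱ), (S, r̃))`. [cite: AroraBarak2009, §1.2] -/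
abbrev sumsE : (ℕ × ℕ) × List ℤ × List ℕ → List Bool :=
  pairE (pairE natE unE) (pairE (rawE intE) (rawE natE))

/-- **The partial sums are computed in polynomial time.** [cite: AroraBarak2009, §1.3] -/
theorem codeFP_sumsL : CodeFP sumsE (rawE intE) (fun p => sumsL p.1.1 p.1.2 p.2.1 p.2.2) := by
  have hpow : CodeFP (pairE (pairE natE unE) (pairE intE natE)) natE (fun t => t.1.1 ^ t.1.2) :=
    natPow.comp ((fst _ _).fst'.pair (fst _ _).snd')
  have hs : CodeFP (pairE (pairE natE unE) (pairE intE natE)) intE (fun t => t.2.1) := (snd _ _).fst'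
  have hm : CodeFP (pairE (pairE natE unE) (pairE intE natE)) intE (fun t => (t.2.2 : ℤ)) :=
    intOfNat.comp (snd _ _).snd'
  have hel := intAdd.comp (hs.pair (intMul.comp ((intOfNat.comp hpow).pair hm)))
  have hel' : CodeFP (pairE (pairE natE unE) (pairE intE natE)) intE
      (fun t => t.2.1 + (t.1.1 : ℤ) ^ t.1.2 * t.2.2) :=
    hel.congr fun t => by push_cast; ring
  exact (zipWith hel').congr fun p => rfl

/-! ### Writing the next window -/

/-- `takeD` past the end pads. [folklore] -/
theorem takeD_of_length_le {α : Type*} (a : α) : ∀ (n : ℕ) (l : List α), l.length ≤ n →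
    List.takeD n l a = l ++ List.replicate (n - l.length) a
  | 0, l, h => by simp [List.eq_nil_of_length_eq_zero (Nat.le_zero.1 h)]
  | n + 1, [], _ => by simp [List.replicate_succ]
  | n + 1, b :: l, h => by
    rw [List.takeD_succ]
    simp only [List.head?_cons, Option.getD_some, List.tail_cons, List.length_cons, Nat.reduceSubDiff,
      List.cons_append]
    rw [takeD_of_length_le a n l (by simpa using h)]

/-- **Code of a window's content**: the iterate (rationals, with length header), the partial sums (raw
integers), the padding. [cite: Regev2009, Lemma 3.5 (proof)] -/
abbrev wE : List ℚ × List ℤ × List Bool → List Bool := pairE (listE encodeRat) (pairE (rawE intE) strE)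

/-- **The next window**: `⟨listE encodeRat L, ⟨rawE intE S, []⟩⟩` cut or zero-padded to width `m`.
[cite: Regev2009, Lemma 3.5 (proof)] -/
def mkWindow (m : ℕ) (L : List ℚ) (S : List ℤ) : List Bool :=
  (boolPair (listE encodeRat L) (boolPair (rawE intE S) [])).takeD m false

/-- The window has the advertised width. [folklore] -/
@[simp] theorem length_mkWindow (m : ℕ) (L : List ℚ) (S : List ℤ) : (mkWindow m L S).length = m := by
  simp [mkWindow]

/-- **When the content fits, the window is the code of the typed triple** `(L, S, padding)`.
[cite: AroraBarak2009, §1.2 (pairing)] -/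
theorem mkWindow_eq_pairE {m : ℕ} {L : List ℚ} {S : List ℤ}
    (h : (boolPair (listE encodeRat L) (boolPair (rawE intE S) [])).length ≤ m) :
    mkWindow m L S = wE (L, S, List.replicate
      (m - (boolPair (listE encodeRat L) (boolPair (rawE intE S) [])).length) false) := by
  have happ : ∀ a b p : List Bool, boolPair a b ++ p = boolPair a (b ++ p) := fun a b p => by
    simp [boolPair]
  rw [mkWindow, takeD_of_length_le false m _ h, happ, happ]
  rfl

/-- Its first field is the code of the iterate (what `LiftPre.exists_liftPre` reads).
[cite: Regev2009, Lemma 3.5 (proof)] -/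
theorem fstF_mkWindow {m : ℕ} {L : List ℚ} {S : List ℤ}
    (h : (boolPair (listE encodeRat L) (boolPair (rawE intE S) [])).length ≤ m) :
    fstF (mkWindow m L S) = listE encodeRat L := by
  rw [mkWindow_eq_pairE h]
  exact fstF_boolPair _ _

/-- Code of the window writer's arguments: `(1ᵐ, (L raw, S))`. [cite: AroraBarak2009, §1.2] -/
abbrev mkE : ℕ × List ℚ × List ℤ → List Bool := pairE unE (pairE (rawE encodeRat) (rawE intE))

/-- **The window is written in polynomial time.** [cite: AroraBarak2009, §1.3] -/
theorem codeFP_mkWindow : CodeFP mkE strE (fun p => mkWindow p.1 p.2.1 p.2.2) := by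
  have hc : CodeFP mkE wE (fun p => (p.2.1, p.2.2, [])) :=
    ((listOfRaw encodeRat).comp (snd _ _).fst').pair ((snd _ _).snd'.pair (const mkE []))
  have hc' : CodeFP mkE strE (fun p => boolPair (listE encodeRat p.2.1) (boolPair (rawE intE p.2.2) [])) :=
    hc.recodeOut fun _ => rfl
  exact (CodeFP.takeD.comp ((fst _ _).pair hc')).congr fun p => rfl

end LiftPost

end Regev2009

end Literature.Computability.Cryptography
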